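import Mathlib.RingTheory.SimpleModule.Isotypic
import Literature.NumberTheory.Automorphic.RestrictedTensorProductProofs
import Literature.NumberTheory.Automorphic.AutomorphicGLn
import HarnessLib

/-!
# Proof of the uniqueness half of Flath's tensor product theorem (`flath_unique_holds`)

This file discharges the named fact `Literature.NumberTheory.Automorphic.flath_unique`
(**lang.S19**, uniqueness of the local factors in Flath's tensor product theorem; Flath,
*Decomposition of representations into tensor products*, Proc. Sympos. Pure Math. 33 (Corvallis
1979), part 1, 179–183, Theorem 3 with Theorem 2; Bump, *Automorphic forms and representations*
(1997), Theorem 3.4.4, "with uniquely determined modules `M_v`") by proving the underlying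
algebraic statement in full generality and then specialising.

## The argument

Let `k` be a field, `(G i)_{i ∈ ι}` groups with subgroups `K i`, and let `(W, π, j)` be a
restricted tensor product `⊗'_i (ρ i, x₀ i)` of representations `ρ i` of `G i` on `V i`
(prelude C14, `IsRestrictedTensorProductRep ρ π hx₀ j S₀`). Fix `i` and restrict `π` to the
`i`-th factor along `G i ↪ Πʳ i, [G i, K i]`, `g ↦ (…, 1, g, 1, …)` (Mathlib's
`RestrictedProduct.mulSingle`; the restriction is written `π.comp (MonoidHom.mk' (mulSingle K i) _)`
throughout, no abbreviation being introduced). For every restricted family `x` the slot map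
`φ_x : v ↦ j (x.update i v)` is a `G i`-intertwining map `V i → W`
(`IsRestrictedTensorProductRep.exists_intertwiningMap_slot`), and the images of the `φ_x`
exhaust `W` because the values `j x = φ_x (x i)` span `W`
(`IsRestrictedTensorProduct.span_range_eq_top` of `RestrictedTensorProductProofs`).
If `ρ i` is irreducible, each `φ_x` is zero or injective (Schur), so `W|_{G i}` is a sum of
copies of `V i`: in Mathlib's language the `k[G i]`-module `W` is *isotypic of type `V i`*
(`IsRestrictedTensorProductRep.isotypicComponent_eq_top`, `IsIsotypicOfType`). If
`(W, π, j')` is also a restricted tensor product of irreducible `ρ' i` on `V' i` and `W ≠ 0`,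
some `φ'_y ≠ 0` embeds `V' i` as a simple `k[G i]`-submodule of `W`, which is therefore
isomorphic to `V i`; hence `ρ i ≅ ρ' i` (`IsRestrictedTensorProductRep.nonempty_equiv`). This
is the classical isotypy argument behind the uniqueness clauses of Flath 1979, Theorems 1–3
(cf. Bump 1997, §3.4); it uses neither admissibility nor the Gelfand-pair hypothesis nor
algebraic closedness, which enter only the existence half (`flath_exists`).
`flath_unique_holds` is the specialisation `k = ℂ`, with `W ≠ 0` supplied by the irreducibility
of `π`.

## Mathlib declarations used

`RestrictedProduct.mulSingle` (the embedding of a factor), `Representation.IntertwiningMap`,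
`Representation.IntertwiningMap.equivLinearMapAsModule` (intertwining maps = `k[G]`-linear maps),
`Representation.IsIrreducible.injective_or_eq_zero` (Schur), `isotypicComponent`,
`IsIsotypicOfType.of_isotypicComponent_eq_top`, `IsSimpleModule.congr`,
`Representation.IntertwiningMap.ofBijective`; from the tree, `RestrictedTensorProductProofs`
(`IsRestrictedTensorProduct.span_range_eq_top`). Theorems only: no definition, no instance, no
named fact (D-0026: net debt delta −1).

## References

* D. Flath, *Decomposition of representations into tensor products*, Proc. Sympos. Pure Math.
  33 (Corvallis 1979), part 1, 179–183, Theorems 2, 3.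
* D. Bump, *Automorphic forms and representations*, Cambridge Stud. Adv. Math. 55 (1997), §3.4,
  Theorem 3.4.4.
-/

noncomputable section

open scoped RestrictedProduct
open Filter

namespace Literature.NumberTheory.Automorphic

universe u uk uG v v' w w'

/-! ### Slot maps of a restricted tensor product representation -/

section Rep

variable {ι : Type u} {k : Type uk} [CommRing k] {G : ι → Type uG} [∀ i, Group (G i)]
  {K : ∀ i, Subgroup (G i)} {V : ι → Type v} [∀ i, AddCommGroup (V i)] [∀ i, Module k (V i)]
  {ρ : ∀ i, Representation k (G i) (V i)} {x₀ : ∀ i, V i} [DecidableEq ι]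
  {W : Type w} [AddCommGroup W] [Module k W]

omit [∀ i, AddCommGroup (V i)] [∀ i, Module k (V i)] in
/-- A restricted family is unchanged by updating a coordinate with its own value. [folklore] -/
@[simp] lemma RestrictedFamily.update_eq_self (x : RestrictedFamily V x₀) (i : ι) :
    x.update i (x i) = x := by
  ext j
  simp

/-- The coordinatewise action of the `i`-th factor `g ↦ (…, 1, g, 1, …)`
(`RestrictedProduct.mulSingle`) on a restricted family only moves the `i`-th coordinate:
`(ι_i g) • (x.update i v) = x.update i (ρ i g v)`. [folklore] -/
lemma RestrictedFamily.smul_mulSingle_update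
    (hx₀ : ∀ᶠ l in cofinite, x₀ l ∈ (ρ l).fixedPoints (K l)) (x : RestrictedFamily V x₀) (i : ι)
    (g : G i) (v : V i) :
    RestrictedFamily.smul ρ hx₀ (RestrictedProduct.mulSingle K i g) (x.update i v) =
      x.update i (ρ i g v) := by
  ext l
  by_cases hl : l = i
  · subst hl
    simp
  · simp [hl]

variable {π : Representation k (Πʳ l, [G l, K l]) W}
  {hx₀ : ∀ᶠ l in cofinite, x₀ l ∈ (ρ l).fixedPoints (K l)}
  {j : RestrictedFamily V x₀ → W} {S₀ : Finset ι}

/-- In a restricted tensor product representation `(W, π, j) = ⊗'_l (ρ l, x₀ l)` the `i`-th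
factor acts through the `i`-th slot: `j (x.update i (ρ i g v)) = π (ι_i g) (j (x.update i v))`
(Flath 1979, §2, Example 2). [folklore] -/
lemma IsRestrictedTensorProductRep.apply_update_apply
    (h : IsRestrictedTensorProductRep ρ π hx₀ j S₀) (x : RestrictedFamily V x₀) (i : ι) (g : G i)
    (v : V i) :
    j (x.update i (ρ i g v)) = π (RestrictedProduct.mulSingle K i g) (j (x.update i v)) := by
  rw [← h.map_smul, RestrictedFamily.smul_mulSingle_update]

/-- **The slot maps are intertwining maps.** In a restricted tensor product representation
`(W, π, j) = ⊗'_l (ρ l, x₀ l)`, for every restricted family `x` the `i`-th slot map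
`φ_x : v ↦ j (x.update i v)` is a `G i`-intertwining map from `ρ i` to the restriction of `π`
to the `i`-th factor `G i →* Πʳ l, [G l, K l]`, `g ↦ (…, 1, g, 1, …)`
(`RestrictedProduct.mulSingle`, a homomorphism by `RestrictedProduct.mulSingle_mul`): linear by
restricted multilinearity of `j`, equivariant by `apply_update_apply` (Flath 1979, §2: the map
`V i → V i ⊗ (⊗'_{l ≠ i} V l) ≅ W`, `v ↦ v ⊗ (⊗_{l ≠ i} x l)`). [folklore] -/
theorem IsRestrictedTensorProductRep.exists_intertwiningMap_slot
    (h : IsRestrictedTensorProductRep ρ π hx₀ j S₀) (x : RestrictedFamily V x₀) (i : ι) :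
    ∃ T : (ρ i).IntertwiningMap (π.comp
      (MonoidHom.mk' (RestrictedProduct.mulSingle K i) (RestrictedProduct.mulSingle_mul K i))),
      ∀ v, T v = j (x.update i v) :=
  ⟨{ toFun := fun v => j (x.update i v)
     map_add' := h.isRestrictedTensorProduct.isRestrictedMultilinear.map_update_add x i
     map_smul' := h.isRestrictedTensorProduct.isRestrictedMultilinear.map_update_smul x i
     isIntertwining' := fun g => LinearMap.ext fun v => by
       show j (x.update i (ρ i g v)) = π (RestrictedProduct.mulSingle K i g) (j (x.update i v))
       exact h.apply_update_apply x i g v }, fun _ => rfl⟩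

end Rep

/-! ### Isotypy of the local factor and uniqueness of the local factors -/

section Field

variable {ι : Type u} {k : Type uk} [Field k] {G : ι → Type uG} [∀ i, Group (G i)]
  {K : ∀ i, Subgroup (G i)} {V : ι → Type v} [∀ i, AddCommGroup (V i)] [∀ i, Module k (V i)]
  {ρ : ∀ i, Representation k (G i) (V i)} {x₀ : ∀ i, V i} [DecidableEq ι]
  {W : Type w} [AddCommGroup W] [Module k W] {π : Representation k (Πʳ l, [G l, K l]) W}
  {hx₀ : ∀ᶠ l in cofinite, x₀ l ∈ (ρ l).fixedPoints (K l)}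
  {j : RestrictedFamily V x₀ → W} {S₀ : Finset ι}

open scoped MonoidAlgebra

/-- **Isotypy of the local factor** (the standard argument behind the uniqueness clauses of
Flath 1979, Theorems 1–3; cf. Bump 1997, §3.4). If `(W, π, j) = ⊗'_l (ρ l, x₀ l)` is a
restricted tensor product representation and `ρ i` is irreducible, then the `k[G i]`-module
`W|_{G i}` (restriction of `π` along `RestrictedProduct.mulSingle K i`) is the sum of its
submodules isomorphic to `V i`, i.e. its `V i`-isotypic component (Mathlib `isotypicComponent`)
is everything: the images of the slot maps `φ_x` (`exists_intertwiningMap_slot`), each zero or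
a copy of `V i` by Schur (`Representation.IsIrreducible.injective_or_eq_zero`), contain the
spanning set `{j x}` (`IsRestrictedTensorProduct.span_range_eq_top`). [folklore] -/
theorem IsRestrictedTensorProductRep.isotypicComponent_eq_top
    (h : IsRestrictedTensorProductRep ρ π hx₀ j S₀) (i : ι) [(ρ i).IsIrreducible] :
    isotypicComponent k[G i] (Representation.asModule (π.comp (MonoidHom.mk'
      (RestrictedProduct.mulSingle K i) (RestrictedProduct.mulSingle_mul K i))))
      (ρ i).asModule = ⊤ := by
  set σ : Representation k (G i) W :=
    π.comp (MonoidHom.mk' (RestrictedProduct.mulSingle K i) (RestrictedProduct.mulSingle_mul K i))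
  set C : Submodule k[G i] σ.asModule := isotypicComponent k[G i] σ.asModule (ρ i).asModule
    with hC
  -- the slot maps, as `k[G i]`-linear maps `L x : V i → W|_{G i}`
  choose T hT using fun x : RestrictedFamily V x₀ => h.exists_intertwiningMap_slot x i
  let L : RestrictedFamily V x₀ → ((ρ i).asModule →ₗ[k[G i]] σ.asModule) := fun x =>
    Representation.IntertwiningMap.equivLinearMapAsModule _ _ (T x)
  have hL : ∀ (x : RestrictedFamily V x₀) (v : V i),
      L x ((ρ i).asModuleEquiv.symm v) = σ.asModuleEquiv.symm (j (x.update i v)) :=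
    fun x v => hT x v
  -- each has range in the isotypic component (Schur: `T x` is zero or injective)
  have hrange : ∀ x, LinearMap.range (L x) ≤ C := by
    intro x
    rcases Representation.IsIrreducible.injective_or_eq_zero (T x) with hinj | h0
    · have hLinj : Function.Injective (L x) := hinj
      exact le_sSup ⟨(LinearEquiv.ofInjective (L x) hLinj).symm⟩
    · have hL0 : L x = 0 := by
        change Representation.IntertwiningMap.equivLinearMapAsModule _ _ (T x) = 0
        rw [h0, map_zero]
      rw [hL0, LinearMap.range_zero]
      exact bot_le
  -- and the `j x = L x (x i)` span `W`
  rw [eq_top_iff]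
  rintro w -
  have hmem : σ.asModuleEquiv w ∈ Submodule.span k (Set.range j) := by
    rw [h.isRestrictedTensorProduct.span_range_eq_top]
    exact Submodule.mem_top
  rw [← σ.asModuleEquiv.symm_apply_apply w]
  generalize σ.asModuleEquiv w = w' at hmem
  induction hmem using Submodule.span_induction with
  | mem w'' hw'' =>
    obtain ⟨x, rfl⟩ := hw''
    rw [← x.update_eq_self i, ← hL x (x i)]
    exact hrange x (LinearMap.mem_range_self _ _)
  | zero => simp
  | add a b _ _ ha hb =>
    rw [map_add]
    exact add_mem ha hb
  | smul c a _ ha =>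
    rw [Representation.asModuleEquiv_symm_map_smul]
    exact C.smul_mem _ ha

/-- **Uniqueness of the local factors of a restricted tensor product** (Flath 1979, Theorem 3,
uniqueness clause; Bump 1997, Theorem 3.4.4, "with uniquely determined modules `M_v`"). Over
any field `k`: if a non-zero representation `π` of `Πʳ l, [G l, K l]` on `W` is a restricted
tensor product of representations `ρ l` (structure map `j`, base vectors `x₀`, exceptional set
`S₀`) and also of representations `ρ' l` (structure map `j'`, base vectors `x₀'`, exceptional
set `S₀'`), and `ρ i`, `ρ' i` are irreducible, then `ρ i ≅ ρ' i`. Proof: `W|_{G i}` is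
`V i`-isotypic (`isotypicComponent_eq_top`) and contains a copy of the simple module `V' i` (the
slot map of the second structure at some `y` with `j' y ≠ 0`, injective by Schur), so
`V' i ≅ V i` as `k[G i]`-modules (`IsIsotypicOfType.of_isotypicComponent_eq_top`), i.e. as
representations (`Representation.IntertwiningMap.equivLinearMapAsModule`, `.ofBijective`). No
admissibility, Gelfand-pair or algebraic-closedness hypothesis is needed.
[cite: FlathCorvallis1979, Theorem 3] -/
theorem IsRestrictedTensorProductRep.nonempty_equiv [Nontrivial W]
    {V' : ι → Type v'} [∀ i, AddCommGroup (V' i)] [∀ i, Module k (V' i)]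
    {ρ' : ∀ i, Representation k (G i) (V' i)} {x₀' : ∀ i, V' i}
    {hx₀' : ∀ᶠ l in cofinite, x₀' l ∈ (ρ' l).fixedPoints (K l)}
    {j' : RestrictedFamily V' x₀' → W} {S₀' : Finset ι}
    (h : IsRestrictedTensorProductRep ρ π hx₀ j S₀)
    (h' : IsRestrictedTensorProductRep ρ' π hx₀' j' S₀') (i : ι) (hρ : (ρ i).IsIrreducible)
    (hρ' : (ρ' i).IsIrreducible) : Nonempty ((ρ i).Equiv (ρ' i)) := by
  haveI : (ρ i).IsIrreducible := hρ
  haveI : (ρ' i).IsIrreducible := hρ'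
  set σ : Representation k (G i) W :=
    π.comp (MonoidHom.mk' (RestrictedProduct.mulSingle K i) (RestrictedProduct.mulSingle_mul K i))
  -- `W|_{G i}` is `V i`-isotypic
  have hiso : IsIsotypicOfType k[G i] σ.asModule (ρ i).asModule :=
    .of_isotypicComponent_eq_top (h.isotypicComponent_eq_top i)
  -- a non-zero value of the second structure map, and the slot map of `j'` there
  obtain ⟨y, hy⟩ : ∃ y : RestrictedFamily V' x₀', j' y ≠ 0 := by
    by_contra! hall
    have htop := h'.isRestrictedTensorProduct.span_range_eq_top
    rw [Submodule.span_eq_bot.2 (by rintro _ ⟨y, rfl⟩; exact hall y)] at htop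
    exact bot_ne_top htop
  obtain ⟨T, hT⟩ := h'.exists_intertwiningMap_slot y i
  have hT0 : T ≠ 0 := by
    intro hT0
    apply hy
    rw [← y.update_eq_self i, ← hT (y i), hT0]
    rfl
  have hTinj : Function.Injective T :=
    (Representation.IsIrreducible.injective_or_eq_zero T).resolve_right hT0
  -- its image is a simple `k[G i]`-submodule of `W|_{G i}`, hence isomorphic to `V i`
  let L : (ρ' i).asModule →ₗ[k[G i]] σ.asModule :=
    Representation.IntertwiningMap.equivLinearMapAsModule _ _ T
  have hL : Function.Injective L := hTinj
  haveI : IsSimpleModule k[G i] (LinearMap.range L) :=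
    IsSimpleModule.congr (LinearEquiv.ofInjective L hL).symm
  obtain ⟨e⟩ := hiso (LinearMap.range L)
  -- back from `k[G i]`-modules to representations
  let E : (ρ i).asModule ≃ₗ[k[G i]] (ρ' i).asModule := ((LinearEquiv.ofInjective L hL).trans e).symm
  exact ⟨((Representation.IntertwiningMap.equivLinearMapAsModule _ _).symm
    E.toLinearMap).ofBijective E.bijective⟩

end Field

/-! ### lang.S19: discharge of `flath_unique` -/

section Flath

variable {ι : Type u} [DecidableEq ι] {G : ι → Type v} [∀ i, Group (G i)]
  [∀ i, TopologicalSpace (G i)] {K : ∀ i, Subgroup (G i)} {W : Type w} [AddCommGroup W]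
  [Module ℂ W]

/-- **lang.S19, uniqueness of the local factors in Flath's tensor product theorem**: discharge
of the named fact `flath_unique` (Flath, *Decomposition of representations into tensor
products*, Proc. Sympos. Pure Math. 33 (Corvallis 1979), part 1, 179–183, Theorem 3, uniqueness
clause; Bump, *Automorphic forms and representations* (1997), Theorem 3.4.4, "with uniquely
determined modules `M_v`"). If an irreducible admissible `π` of `Πʳ i, [G i, K i]` is a
restricted tensor product of irreducible admissible `ρ i` and also of irreducible admissible
`ρ' i`, then `ρ i ≅ ρ' i` for every `i`. This is the specialisation
`k = ℂ` of `IsRestrictedTensorProductRep.nonempty_equiv`; non-triviality of `W` comes from the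
irreducibility of `π`, while the admissibility, compact-openness and Gelfand-pair hypotheses of
the fact are not needed for uniqueness (they enter the existence half `flath_exists`).
[cite: FlathCorvallis1979, Theorem 3] -/
theorem flath_unique_holds : flath_unique.{u, v, w, w'} (K := K) (W := W) := by
  intro _ _ _ π hirr _ V _ _ ρ x₀ hx₀ j S₀ V' _ _ ρ' x₀' hx₀' j' S₀' h hρ h' hρ' i
  haveI : IsSimpleModule (MonoidAlgebra ℂ (Πʳ i, [G i, K i])) π.asModule :=
    (Representation.irreducible_iff_isSimpleModule_asModule π).1 hirr
  haveI : Nontrivial π.asModule :=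
    IsSimpleModule.nontrivial (MonoidAlgebra ℂ (Πʳ i, [G i, K i])) _
  haveI : Nontrivial W := π.asModuleEquiv.injective.nontrivial
  exact h.nonempty_equiv h' i (hρ i).1 (hρ' i).1

end Flath

end Literature.NumberTheory.Automorphic
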